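import Mathlib
import Summits.ValiantsHypothesis.ValiantsHypothesis.Theses.ValuativeGCT
import Literature.NumberTheory.DiophantineGeometry.DetStabilizerFrobenius

/-!
# Line `pencil-degree-frobenius` — skeleton for crux `ValuativeGCT.CutBites`
# (stmt-ValiantsHypothesis-12626, route-ValiantsHypothesis-ValuativeGCT; crux-plan, round 1)

**Idea (card `pencil-degree-frobenius`, ideator 1; triage r1: pass ×3, merge ≈ `segre-ruling-stabiliser`).**
Every proving line for `CutBites` exhibits ONE `Stab_End(det_m)`-invariant form `G` of degree `mδ`
with ONE non-zero value on `L_Λ = {all rows skew}` and then runs the cut criterion (Disproof §B).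
Invariance under the ABSTRACT stabiliser `{M | linSubst M det_m = det_m}` (the crux's third factor,
singular `M` a priori allowed) is the one non-elementary input: Frobenius 1897 / Marcus–Moyls 1959,
in tree only as the NAMED FACT `frobenius_detPreserver_unimodular_sandwich` (DetStabilizerFrobenius).
This line DISCHARGES that fact by linear algebra — the lever is the pencil degree
`rank X = max_Y deg_t det(Y + tX)` (stub 1), whence determinant preservers are rank non-decreasing,
hence bijective, hence rank preserving (stub 2), hence (transposed) sandwiches by Marcus–Moyls for
bijective rank preservers (stub 3), normalised to `det P = det Q = 1` over `ℂ` (stub 4 = the fact,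
verbatim) — and then closes the crux at the first rung `δ = 2` with the `2 × 2` block-determinant
witness (stub 5: invariant under every unimodular (transposed) sandwich acting row-wise, value
`2·det Z_m = 2` at the skew point of the item evidence) and highest-weight extraction (stubs 6–7:
semisimplicity + Lie–Kolchin + torus bookkeeping, all three classification facts DISCHARGED in tree).

**Shape.** `CutBites_of : CutBites` (no hypotheses) is proved here from the seven `stub_*` and the
sorry-free bookkeeping of Disproof §0/§B (copied below so that the skeleton does not import a living
workfile); `sorry` occurs only inside `stub_*`.  Stub statements mention only Mathlib, `Literature.*` and
the route file, so each can land as `Theorems/ValuativeGCTCutBites<Stub>.lean` with `--supports`.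

**Disproof used** (`Cruxes/CutBites/Disproof.lean`, cdisprove gen 2, 2026-08-15):
`cutBites_false_without_three_le` — `3 ≤ m` is consumed by `stub_blowupWitness` (four distinct row
slots, `m² ≥ 4`, and the odd skew witness `Z_m`); `not_cutBitesAtDeltaOne` / `truncSkew_one_eq_zero_of_odd`
(parity: odd `mδ` never cuts) — the line works at `δ = 2` (`CutBites_of` supplies `δ := 2`, degree
`m * 2`); §C.2/§C.4 of gen 1 (compression / block-compression spaces never cut) — `U = Λ_m` throughout;
§D conventions (weight `-mδ` on the LAST lex index, `G ↦ G(g⁻¹A)`, bottom-justified minors) — stub 7 is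
stated in exactly these conventions (`Weight.dualOfPartition (m*m) lam).toMatIdx`).  No `Negative/` lemma
has landed for this crux (nothing to import); no stub is an instance of a refuted strengthening.
-/

namespace Summit.ValiantsHypothesis.ValiantsHypothesis.Cruxes.CutBites.PencilDegreeFrobenius

open MvPolynomial
open scoped BigOperators Matrix Polynomial
open Literature.NumberTheory.DiophantineGeometry
open Literature.Computability.AlgebraicComplexity

set_option linter.dupNamespace false

noncomputable section

/-! ## The seven stubs -/

/-- **Stub 1 — the lever: rank = maximal pencil degree.**  For every square complex matrix `A`,
`deg_t det(B + tA) ≤ rank A` for every `B`, with equality for some `B`.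
Why true: `A = L·D·L'` with `L, L'` products of transvections and `D` diagonal
(`Matrix.Pivot.exists_list_transvec_mul_diagonal_mul_list_transvec`), `rank A = #{i | D i ≠ 0}`
(`Matrix.rank_diagonal`, `rank_mul_eq_left/right_of_isUnit_det`); then
`det(B + tA) = det L · det(L⁻¹ B L'⁻¹ + tD) · det L'` and in `B' + tD` only the `rank A` columns with
`D i ≠ 0` carry `t`, so Leibniz bounds the degree column-wise (tree:
`Literature…EFunctionValuesAtAlgebraicPointsForms.natDegree_det_le_of_column`, or
`natDegree_det_le_of_forall_le`-style); equality at `B' = diag(𝟙_{D i = 0})`, where the determinant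
is `± (∏_{D i ≠ 0} D i) · t^{rank A}`.  Size M (~250 lines).  [Marcus–Moyls 1959 Lemma 7 uses the same
quantity; folklore "rank = degree of the pencil".] -/
theorem stub_pencilRank (m : ℕ) (A : Matrix (Fin m) (Fin m) ℂ) :
    (∀ B : Matrix (Fin m) (Fin m) ℂ,
        (B.map Polynomial.C + (Polynomial.X : Polynomial ℂ) • A.map Polynomial.C).det.natDegree
          ≤ A.rank) ∧
      ∃ B : Matrix (Fin m) (Fin m) ℂ,
        (B.map Polynomial.C + (Polynomial.X : Polynomial ℂ) • A.map Polynomial.C).det.natDegree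
          = A.rank := by
  sorry

/-- **Stub 2 — determinant preservers are bijective rank preservers** (Marcus–Moyls 1959 Lemma 7 +
the rank half of their Thm 2, via stub 1; no geometry, `M` NOT assumed invertible).
If `linSubst M det_m = det_m` (i.e. `T_M : X ↦ mat(Mᵀ · vec X)` preserves `det`, the tree's column
convention `X i ↦ ∑ j, M j i • X j`), then `M` is invertible and `T_M` preserves the rank of every matrix.
Why true: the polynomial identity specialises to matrices over `ℂ[t]` (`MvPolynomial.aeval`), so
`det(T_M B + t·T_M A) = det(B + tA)`; with stub 1, `rank A = deg det(B₀ + tA) = deg det(T_M B₀ + t T_M A)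
≤ rank (T_M A)`: `T_M` is rank non-decreasing, hence injective (`T_M A = 0 ⇒ rank A = 0`), hence
`IsUnit M.det` (`Matrix.mulVec_injective_iff_isUnit` for `Mᵀ`, `Matrix.det_transpose`); `M⁻¹` again
preserves `det_m` (`linSubst_mul`, `linSubst_one`), so `T_M⁻¹ = T_{M⁻¹}` is rank non-decreasing too and
the ranks agree.  Size M (~250 lines; the `ℂ[t]`-specialisation of `linSubst` is the Lean cost). -/
theorem stub_rankPreserver
    (hpencil : ∀ (m : ℕ) (A : Matrix (Fin m) (Fin m) ℂ),
      (∀ B : Matrix (Fin m) (Fin m) ℂ,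
          (B.map Polynomial.C + (Polynomial.X : Polynomial ℂ) • A.map Polynomial.C).det.natDegree
            ≤ A.rank) ∧
        ∃ B : Matrix (Fin m) (Fin m) ℂ,
          (B.map Polynomial.C + (Polynomial.X : Polynomial ℂ) • A.map Polynomial.C).det.natDegree
            = A.rank)
    (m : ℕ) (M : Matrix (MatIdx m) (MatIdx m) ℂ)
    (hM : linSubst (MatIdx m) ℂ M (detFormLex ℂ m) = detFormLex ℂ m) :
    IsUnit M.det ∧
      ∀ x : MatIdx m → ℂ,
        (Matrix.of fun a b : Fin m => (Mᵀ *ᵥ x) (toLex (a, b))).rank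
          = (Matrix.of fun a b : Fin m => x (toLex (a, b))).rank := by
  sorry

/-- **Stub 3 — Marcus–Moyls: a bijective rank-preserving linear map of `M_m(ℂ)` is a (transposed)
sandwich** `A ↦ P A Q` or `A ↦ P Aᵀ Q` with `P, Q` invertible (Marcus–Moyls 1959 Thm 1 / Thm 2
(i)⇒(iii), stated with the stronger hypotheses the line actually has: bijective AND rank-preserving in
every rank, so any of the classical proofs — Marcus–Moyls, Hua, Dieudonné via maximal singular spaces,
Westwick — may be followed).  Route suggested by the card: the maximal linear spaces of rank-`≤ 1`
matrices are the rulings `C_v = {v wᵀ}` and `R_w = {v wᵀ}` of the Segre variety; `T` permutes them,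
preserving or swapping the two families (`C_v ∩ C_v' = 0`, `C_v ∩ R_w` a line), so after composing
with `ᵀ` in the swapped case `T(v wᵀ) = (Pv)(Qᵀw)ᵀ` up to scalars, and projective agreement on rank-2
sums forces the scalars to be constant.  Degenerate sizes are true as typed (`m = 0`: `P = Q = 1`;
`m = 1`: `T = c·id`, `P = c`, `Q = 1`).  THE HARDEST STUB (size L, ~700–1000 lines; classical, no
library support for linear preserver problems in Mathlib). -/
theorem stub_marcusMoyls (m : ℕ)
    (T : Matrix (Fin m) (Fin m) ℂ →ₗ[ℂ] Matrix (Fin m) (Fin m) ℂ)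
    (hT : Function.Bijective T) (hrank : ∀ A : Matrix (Fin m) (Fin m) ℂ, (T A).rank = A.rank) :
    ∃ P Q : Matrix (Fin m) (Fin m) ℂ, IsUnit P.det ∧ IsUnit Q.det ∧
      ((∀ A : Matrix (Fin m) (Fin m) ℂ, T A = P * A * Q) ∨
        (∀ A : Matrix (Fin m) (Fin m) ℂ, T A = P * Aᵀ * Q)) := by
  sorry

/-- **Stub 4 — Frobenius' determinant-preserver theorem, i.e. the tree's NAMED FACT
`frobenius_detPreserver_unimodular_sandwich` verbatim, from stubs 2 and 3** (this is the discharge of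
cite item wi-26984; triage r1-1 sharpening: target the unimodular normalisation `det P = det Q = 1`).
Why true: for `M` with `linSubst M det_m = det_m`, stub 2 makes `T_M : A ↦ mat(Mᵀ · vec A)` a bijective
rank-preserving LINEAR map of `M_m(ℂ)`; stub 3 writes it as `P₀ A Q₀` or `P₀ Aᵀ Q₀`; evaluating the
polynomial identity at `vec A` gives `det (T_M A) = det A` (`eval x (linSubst M f) = eval (Mᵀ *ᵥ x) f`,
`detFormLex = rename toLex detPoly`), so `A = 1` yields `det P₀ · det Q₀ = 1`; for `m ≥ 1` pick `c` with
`c ^ m = det Q₀` (`IsAlgClosed.exists_pow_nat_eq`) and put `P = c • P₀`, `Q = c⁻¹ • Q₀`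
(`Matrix.det_smul`, `Fintype.card_fin`); `m = 0` is the empty matrix (`P = Q = 1`, `Subsingleton`).
Size M (~250 lines). -/
theorem stub_frobenius_of
    (hrank : ∀ (m : ℕ) (M : Matrix (MatIdx m) (MatIdx m) ℂ),
      linSubst (MatIdx m) ℂ M (detFormLex ℂ m) = detFormLex ℂ m →
      IsUnit M.det ∧
        ∀ x : MatIdx m → ℂ,
          (Matrix.of fun a b : Fin m => (Mᵀ *ᵥ x) (toLex (a, b))).rank
            = (Matrix.of fun a b : Fin m => x (toLex (a, b))).rank)
    (hMM : ∀ (m : ℕ) (T : Matrix (Fin m) (Fin m) ℂ →ₗ[ℂ] Matrix (Fin m) (Fin m) ℂ),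
      Function.Bijective T → (∀ A : Matrix (Fin m) (Fin m) ℂ, (T A).rank = A.rank) →
      ∃ P Q : Matrix (Fin m) (Fin m) ℂ, IsUnit P.det ∧ IsUnit Q.det ∧
        ((∀ A : Matrix (Fin m) (Fin m) ℂ, T A = P * A * Q) ∨
          (∀ A : Matrix (Fin m) (Fin m) ℂ, T A = P * Aᵀ * Q))) :
    frobenius_detPreserver_unimodular_sandwich := by
  sorry

/-- **Stub 5 — the `δ = 2` witness: a degree-`2m` form on `End(ℂ^{m×m})`, invariant under every
unimodular (transposed) sandwich acting row-wise, with a non-zero value at a point of `L_Λ`.**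
The hypothesis on `M` is LITERALLY the conclusion of the named fact for `M`, so the stub composes with
stub 4 into invariance under the abstract stabiliser (done in `CutBites_of`); it assumes nothing about
`det`-preservers itself.  Witness (item evidence rattack-12626 / CutProbe, 2026-08-15): fix four distinct
row slots `r₁ r₂ r₃ r₄ : MatIdx m` (needs `m² ≥ 4`), let `X_j(A) = mat(row r_j of A)` and
`F(A) = det (Matrix.fromBlocks X₁ X₂ X₃ X₄)` (a `2m × 2m` determinant, homogeneous of degree `2m = m*2`),
`G = F + F ∘ τ̃` with `τ̃` = transpose every row (`rename`).  Row-wise `X ↦ P X Q` multiplies `F` and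
`F ∘ τ̃` by `(det P det Q)² = 1` (`Matrix.fromBlocks_multiply` with block-diagonal `P ⊕ P`, `Q ⊕ Q`,
`det_fromBlocks_zero₂₁`); row-wise `X ↦ P Xᵀ Q` swaps the two summands up to the same factor — so
`aeval(φ_M) G = G` (prove the identity on values, `MvPolynomial.funext`; the substitution `φ_M` replaces
row `j` by `Mᵀ *ᵥ row j`, i.e. `X_j ↦ mat(Mᵀ · vec X_j)`).  Value: at the skew point `A₀` with rows
`r₁ ↦ J, r₂ ↦ K, r₃ ↦ K, r₄ ↦ J'`, all other rows `0` (`J = J₁₂+J₃₄+…+J_{m-2,m-1}`,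
`J' = J₂₃+J₄₅+…+J_{m-1,m}`, `K = J_{1m}`, `J_ab = E_ab - E_ba`), `F(A₀) = det Z_m`,
`F(τ̃A₀) = det(-Z_m) = det Z_m`, and `det Z_m = 1` for every odd `m ≥ 3` (exact check m ≤ 13 in the item
evidence, m ≤ 11 re-run by this planner; general `m`: Laplace along the perfect matching structure /
`Z_m` is a signed permutation matrix of an even permutation composed with … — the prover may instead
use the symmetric `2 × 2` blow-up `det(∑ T_i ⊗ X_i) = 4` of card pfaffian-square-address, block form
`K₃ ⊕ (I₂ ⊗ J_{m-3})`, `Matrix.det_fromBlocks_zero₂₁` + `Matrix.det_kronecker`).  For even `m` the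
statement is also true (`X₁ = X₄ = J_m`, `X₂ = X₃ = 0`), so `hm` is a convenience, `h3` gives the four
slots.  Size M (~300 lines: the `aeval`/`fromBlocks` plumbing and one explicit determinant). -/
theorem stub_blowupWitness (m : ℕ) (hm : Odd m) (h3 : 3 ≤ m) :
    ∃ G : MvPolynomial (MatIdx m × MatIdx m) ℂ,
      G.IsHomogeneous (m * 2) ∧
      (∀ M : Matrix (MatIdx m) (MatIdx m) ℂ,
        (∃ P Q : Matrix (Fin m) (Fin m) ℂ, P.det = 1 ∧ Q.det = 1 ∧
          ((∀ x : MatIdx m → ℂ,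
              (Matrix.of fun a b : Fin m => (Mᵀ *ᵥ x) (toLex (a, b))) =
                P * (Matrix.of fun a b : Fin m => x (toLex (a, b))) * Q) ∨
           (∀ x : MatIdx m → ℂ,
              (Matrix.of fun a b : Fin m => (Mᵀ *ᵥ x) (toLex (a, b))) =
                P * (Matrix.of fun a b : Fin m => x (toLex (a, b)))ᵀ * Q))) →
        MvPolynomial.aeval (R := ℂ) (fun p : MatIdx m × MatIdx m =>
          ∑ l : MatIdx m, M l p.2 • MvPolynomial.X (p.1, l)) G = G) ∧
      ∃ p : MatIdx m × MatIdx m → ℂ,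
        (∀ j : MatIdx m, (fun i => p (j, i)) ∈
          Submodule.span ℂ {u : MatIdx m → ℂ | ∀ a b : Fin m, u (toLex (a, b)) = -u (toLex (b, a))}) ∧
        MvPolynomial.eval p G ≠ 0 := by
  sorry

/-- **Stub 6 — highest-weight extraction (complete reducibility + Lie–Kolchin).**  On
`ℂ[End W]_D` (forms of degree `D` in the entries `A (j, i)`), `GL(MatIdx m)` acts on the left by
`ψ_g : X (j,i) ↦ ∑ l, (g⁻¹) j l • X (l,i)` (`G ↦ G(g⁻¹A)`, the crux's Borel action) and any set `S` of
matrices acts on the right by `φ_M : X (j,i) ↦ ∑ l, M l i • X (j,l)` (`G ↦ G(AM)`); the two commute.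
If some `S`-invariant form of degree `D` does not vanish at a point of `L_U = {A | every row ∈ U}`, then
some `S`-invariant form of degree `D` which is moreover a `B`-semi-invariant (of some weight `χ`) does
not vanish at a point of `L_U` either.  Why true: `V_S = Hom_D ∩ (S-invariants)` is a finite-dimensional
`GL`-subrepresentation of `ψ` (commuting actions), rational (coefficients polynomial in `g⁻¹ =
adj g / det g`); `W = V_S ∩ I(L_U)` is a subrepresentation (`L_U` is stable under `A ↦ gA`); `G ∈ V_S ∖ W`,
so by complete reducibility (tree, DISCHARGED: `isSemisimpleRepresentation_of_isRationalRep_holds`;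
`Representation.IsSemisimpleRepresentation = ComplementedLattice (Subrepresentation _)`) `W` has a
non-zero `GL`-stable complement `W'`, which has a highest-weight vector (tree, DISCHARGED:
`exists_hasHighestWeight_of_finiteDimensional_holds`, `IsAlgClosed ℂ`); it lies outside `W`, i.e. has a
non-zero value on `L_U`.  Size M–L (~400 lines: the `Representation` structure on `V_S`, its
rationality, and moving semi-invariance between `V_S` and the ambient ring). -/
theorem stub_hwExtraction (m D : ℕ) (S : Set (Matrix (MatIdx m) (MatIdx m) ℂ))
    (U : Submodule ℂ (MatIdx m → ℂ)) (G : MvPolynomial (MatIdx m × MatIdx m) ℂ)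
    (hG : G.IsHomogeneous D)
    (hS : ∀ M ∈ S, MvPolynomial.aeval (R := ℂ) (fun p : MatIdx m × MatIdx m =>
        ∑ l : MatIdx m, M l p.2 • MvPolynomial.X (p.1, l)) G = G)
    (hp : ∃ p : MatIdx m × MatIdx m → ℂ, (∀ j : MatIdx m, (fun i => p (j, i)) ∈ U) ∧
        MvPolynomial.eval p G ≠ 0) :
    ∃ (χ : Weight (MatIdx m)) (G' : MvPolynomial (MatIdx m × MatIdx m) ℂ),
      G'.IsHomogeneous D ∧
      (∀ M ∈ S, MvPolynomial.aeval (R := ℂ) (fun p : MatIdx m × MatIdx m =>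
          ∑ l : MatIdx m, M l p.2 • MvPolynomial.X (p.1, l)) G' = G') ∧
      (∀ g : Matrix.GeneralLinearGroup (MatIdx m) ℂ, IsUpperTriangular g →
          MvPolynomial.aeval (R := ℂ) (fun p : MatIdx m × MatIdx m =>
            ∑ l : MatIdx m, ((g⁻¹ : Matrix.GeneralLinearGroup (MatIdx m) ℂ) :
              Matrix (MatIdx m) (MatIdx m) ℂ) p.1 l • MvPolynomial.X (l, p.2)) G'
            = weightChar χ g • G') ∧
      ∃ p : MatIdx m × MatIdx m → ℂ, (∀ j : MatIdx m, (fun i => p (j, i)) ∈ U) ∧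
        MvPolynomial.eval p G' ≠ 0 := by
  sorry

/-- **Stub 7 — weights of semi-invariant forms are duals of partitions** (the route's weight
convention, Disproof §D: weight `-D` sits on the LAST lex index for `λ = (D)`).  A non-zero form `G'` of
degree `D` on `End(ℂ^{m×m})` which is a `B`-semi-invariant of weight `χ` for `G ↦ G(g⁻¹A)` has
`χ = (Weight.dualOfPartition (m*m) λ).toMatIdx` for a partition `λ ⊢ D` with at most `m²` parts.
Why true: diagonal `g = diag(t)` rescales `X (j,i) ↦ t_j⁻¹ X (j,i)`, so every monomial of `G'` has the
same row-degree vector `r` and `χ = -r` (`weightChar χ (diag t) = ∏ t_j ^ χ_j`; Laurent monomials in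
`t` are distinct functions), `∑ r_j = D`, `r_j ≥ 0`; dominance of `χ` (tree, DISCHARGED:
`isDominant_of_hasHighestWeight_holds` for the rational f.d. representation `Hom_D`, or directly from
semi-invariance under the transvections `1 + s E_{j,j+1}`) makes `r` weakly increasing along the lex
order, so `λ := (r_N ≥ … ≥ r_1, zeros dropped)` is a partition of `D` with `≤ N = m*m` parts and
`dualOfPartition (m*m) λ = (0,…,0,-λ_ℓ,…,-λ_1) = -r` read through `matIdxEquiv`
(`Weight.dualOfPartition`, `Weight.ofPartition`, `Nat.Partition.sortedParts`, cf. Disproof §D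
`chiRow_apply`).  Size M (~300 lines, bookkeeping-heavy). -/
theorem stub_weightOfPartition (m D : ℕ) (χ : Weight (MatIdx m))
    (G' : MvPolynomial (MatIdx m × MatIdx m) ℂ) (hG'0 : G' ≠ 0) (hG' : G'.IsHomogeneous D)
    (hhw : ∀ g : Matrix.GeneralLinearGroup (MatIdx m) ℂ, IsUpperTriangular g →
      MvPolynomial.aeval (R := ℂ) (fun p : MatIdx m × MatIdx m =>
        ∑ l : MatIdx m, ((g⁻¹ : Matrix.GeneralLinearGroup (MatIdx m) ℂ) :
          Matrix (MatIdx m) (MatIdx m) ℂ) p.1 l • MvPolynomial.X (l, p.2)) G'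
        = weightChar χ g • G') :
    ∃ lam : Nat.Partition D, lam.parts.card ≤ m * m ∧
      χ = (Weight.dualOfPartition (m * m) lam).toMatIdx := by
  sorry

/-! ## Bookkeeping (sorry-free): §0/§B of the standing `Disproof.lean` (cdisprove gen 2), copied so
that this skeleton does not depend on a living workfile -/

/-- Index type of the coordinates `A (j, i)` of `End(ℂ^{m×m})` (row `j`, column `i`). -/
abbrev Idx (m : ℕ) : Type := MatIdx m × MatIdx m

/-- `Λ_m` — verbatim the crux's `U`. -/
def skewU (m : ℕ) : Submodule ℂ (MatIdx m → ℂ) :=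
  Submodule.span ℂ {u : MatIdx m → ℂ | ∀ a b : Fin m, u (toLex (a, b)) = -u (toLex (b, a))}

/-- `L_U = {A : every row of A lies in U}` — verbatim the crux's point set. -/
def locus (m : ℕ) (U : Submodule ℂ (MatIdx m → ℂ)) : Set (Idx m → ℂ) :=
  {p : Idx m → ℂ | ∀ j : MatIdx m, (fun i => p (j, i)) ∈ U}

/-- `P_U`, the vanishing ideal of `L_U`. -/
def vanI (m : ℕ) (U : Submodule ℂ (MatIdx m → ℂ)) : Ideal (MvPolynomial (Idx m) ℂ) :=
  MvPolynomial.vanishingIdeal ℂ (locus m U)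

/-- Right invariance under the `End`-stabiliser of `det_m` — verbatim the crux's third factor. -/
def stabInv (m : ℕ) : Submodule ℂ (MvPolynomial (Idx m) ℂ) :=
  ⨅ (M : Matrix (MatIdx m) (MatIdx m) ℂ)
    (_ : linSubst (MatIdx m) ℂ M (detFormLex ℂ m) = detFormLex ℂ m),
    LinearMap.ker ((MvPolynomial.aeval (R := ℂ) fun p : Idx m =>
      ∑ l : MatIdx m, M l p.2 • MvPolynomial.X (p.1, l)).toLinearMap
      - LinearMap.id (R := ℂ) (M := MvPolynomial (Idx m) ℂ))

/-- Left `B`-semi-invariance of weight `χ` — verbatim the crux's fourth factor. -/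
def hwSp (m : ℕ) (χ : Weight (MatIdx m)) : Submodule ℂ (MvPolynomial (Idx m) ℂ) :=
  ⨅ (g : Matrix.GeneralLinearGroup (MatIdx m) ℂ) (_ : IsUpperTriangular g),
    LinearMap.ker ((MvPolynomial.aeval (R := ℂ) fun p : Idx m =>
      ∑ l : MatIdx m, ((g⁻¹ : Matrix.GeneralLinearGroup (MatIdx m) ℂ) :
        Matrix (MatIdx m) (MatIdx m) ℂ) p.1 l • MvPolynomial.X (l, p.2)).toLinearMap
      - weightChar χ g • LinearMap.id (R := ℂ) (M := MvPolynomial (Idx m) ℂ))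

/-- The truncation in degree `D`, row space `U`, weight `χ`, threshold `t`. -/
def truncU (m D : ℕ) (U : Submodule ℂ (MatIdx m → ℂ)) (χ : Weight (MatIdx m)) (t : ℕ) :
    Submodule ℂ (MvPolynomial (Idx m) ℂ) :=
  MvPolynomial.homogeneousSubmodule (Idx m) ℂ D ⊓ ((vanI m U) ^ t).restrictScalars ℂ
    ⊓ stabInv m ⊓ hwSp m χ

/-- The crux's `T t` at `(m, δ, λ)`: `truncU` at `D = mδ`, `U = Λ_m`, `χ = λ*`. -/
def trunc (m δ : ℕ) (lam : Nat.Partition (m * δ)) (t : ℕ) : Submodule ℂ (MvPolynomial (Idx m) ℂ) :=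
  truncU m (m * δ) (skewU m) (Weight.dualOfPartition (m * m) lam).toMatIdx t

/-- The crux, unbundled (definitional). -/
theorem cutBites_iff :
    Summit.ValiantsHypothesis.ValiantsHypothesis.Theses.ValuativeGCT.CutBites ↔
      ∀ m : ℕ, Odd m → 3 ≤ m → ∃ (δ : ℕ) (lam : Nat.Partition (m * δ)),
        lam.parts.card ≤ m * m ∧
          Module.finrank ℂ ↥(trunc m δ lam δ) < Module.finrank ℂ ↥(trunc m δ lam 0) :=
  Iff.rfl

section Criterion

variable {m D : ℕ} {U : Submodule ℂ (MatIdx m → ℂ)} {χ : Weight (MatIdx m)}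

theorem truncU_le_zero (t : ℕ) : truncU m D U χ t ≤ truncU m D U χ 0 := by
  unfold truncU
  exact inf_le_inf_right _ (inf_le_inf_right _ (inf_le_inf_left _
    (Submodule.restrictScalars_mono ℂ (Ideal.pow_le_pow_right (Nat.zero_le t)))))

theorem truncU_zero :
    truncU m D U χ 0 = MvPolynomial.homogeneousSubmodule (Idx m) ℂ D ⊓ stabInv m ⊓ hwSp m χ := by
  unfold truncU
  rw [pow_zero, Ideal.one_eq_top, Submodule.restrictScalars_top, inf_top_eq]

instance finiteDimensional_truncU (t : ℕ) : FiniteDimensional ℂ ↥(truncU m D U χ t) := by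
  have : Module.Finite ℂ ↥(MvPolynomial.homogeneousSubmodule (Idx m) ℂ D) :=
    Module.Finite.iff_fg.mpr (MvPolynomial.homogeneousSubmodule_fg (Idx m) ℂ D)
  have hle : truncU m D U χ t ≤ MvPolynomial.homogeneousSubmodule (Idx m) ℂ D := by
    unfold truncU
    exact inf_le_left.trans (inf_le_left.trans inf_le_left)
  exact Submodule.finiteDimensional_of_le hle

theorem eval_eq_zero_of_mem_truncU {t : ℕ} (ht : 0 < t) {G : MvPolynomial (Idx m) ℂ}
    (hG : G ∈ truncU m D U χ t) {p : Idx m → ℂ} (hp : p ∈ locus m U) :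
    MvPolynomial.eval p G = 0 := by
  have h1 : truncU m D U χ t ≤ (vanI m U).restrictScalars ℂ := by
    unfold truncU
    refine inf_le_left.trans (inf_le_left.trans (inf_le_right.trans ?_))
    exact Submodule.restrictScalars_mono ℂ ((Ideal.pow_le_pow_right ht).trans_eq (pow_one _))
  have h := h1 hG
  rw [Submodule.restrictScalars_mem, vanI, mem_vanishingIdeal_iff] at h
  simpa [MvPolynomial.coe_aeval_eq_eval] using h p hp

/-- **Cut criterion** (Disproof §B): an element of `T(0)` with one non-zero value on `L_U` forces
`finrank T(t) < finrank T(0)` for every `t ≥ 1`. -/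
theorem finrank_lt_of_eval_ne_zero {t : ℕ} (ht : 0 < t) {G : MvPolynomial (Idx m) ℂ}
    (hG : G ∈ truncU m D U χ 0) {p : Idx m → ℂ} (hp : p ∈ locus m U)
    (hGp : MvPolynomial.eval p G ≠ 0) :
    Module.finrank ℂ ↥(truncU m D U χ t) < Module.finrank ℂ ↥(truncU m D U χ 0) := by
  refine Submodule.finrank_lt_finrank_of_lt (lt_of_le_of_ne (truncU_le_zero t) fun h => hGp ?_)
  have hG' : G ∈ truncU m D U χ t := by rw [h]; exact hG
  exact eval_eq_zero_of_mem_truncU ht hG' hp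

end Criterion

theorem mem_stabInv_iff {m : ℕ} {G : MvPolynomial (Idx m) ℂ} :
    G ∈ stabInv m ↔ ∀ M : Matrix (MatIdx m) (MatIdx m) ℂ,
      linSubst (MatIdx m) ℂ M (detFormLex ℂ m) = detFormLex ℂ m →
      MvPolynomial.aeval (R := ℂ) (fun p : Idx m =>
        ∑ l : MatIdx m, M l p.2 • MvPolynomial.X (p.1, l)) G = G := by
  simp only [stabInv, Submodule.mem_iInf, LinearMap.mem_ker, LinearMap.sub_apply, sub_eq_zero,
    AlgHom.toLinearMap_apply, LinearMap.id_coe, id_eq]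

theorem mem_hwSp_iff {m : ℕ} {χ : Weight (MatIdx m)} {G : MvPolynomial (Idx m) ℂ} :
    G ∈ hwSp m χ ↔ ∀ g : Matrix.GeneralLinearGroup (MatIdx m) ℂ, IsUpperTriangular g →
      MvPolynomial.aeval (R := ℂ) (fun p : Idx m =>
        ∑ l : MatIdx m, ((g⁻¹ : Matrix.GeneralLinearGroup (MatIdx m) ℂ) :
          Matrix (MatIdx m) (MatIdx m) ℂ) p.1 l • MvPolynomial.X (l, p.2)) G = weightChar χ g • G := by
  simp only [hwSp, Submodule.mem_iInf, LinearMap.mem_ker, LinearMap.sub_apply, sub_eq_zero,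
    AlgHom.toLinearMap_apply, LinearMap.smul_apply, LinearMap.id_coe, id_eq]

/-! ## Glue (sorry-free): the crux from the seven stubs -/

/-- **`CutBites` from the line.**  For odd `m ≥ 3`: Frobenius (stubs 1–4) turns the abstract
stabiliser condition into unimodular (transposed) sandwiches, under which the `δ = 2` witness of
stub 5 is invariant, with a non-zero value on `L_Λ`; stubs 6–7 replace it by a highest-weight vector
of a partition weight `λ* ⊢ 2m` with the same two properties, i.e. an element of `T(0)` at
`(m, δ = 2, λ)` not vanishing on `L_Λ`; the cut criterion (Disproof §B) gives
`finrank T(2) < finrank T(0)`. -/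
theorem CutBites_of : Summit.ValiantsHypothesis.ValiantsHypothesis.Theses.ValuativeGCT.CutBites := by
  rw [cutBites_iff]
  intro m hm h3
  -- Frobenius' theorem for the abstract `End`-stabiliser, discharged by stubs 1–4
  have hFrob : frobenius_detPreserver_unimodular_sandwich :=
    stub_frobenius_of (stub_rankPreserver stub_pencilRank) stub_marcusMoyls
  -- the explicit order-zero invariant (stub 5), invariant under the abstract stabiliser
  obtain ⟨G, hGhom, hGinv, p, hp, hGp⟩ := stub_blowupWitness m hm h3
  have hGstab : ∀ M ∈ {M : Matrix (MatIdx m) (MatIdx m) ℂ |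
        linSubst (MatIdx m) ℂ M (detFormLex ℂ m) = detFormLex ℂ m},
      MvPolynomial.aeval (R := ℂ) (fun q : MatIdx m × MatIdx m =>
        ∑ l : MatIdx m, M l q.2 • MvPolynomial.X (q.1, l)) G = G :=
    fun M hM => hGinv M (hFrob m M hM)
  -- highest-weight extraction (stub 6) and the partition weight (stub 7)
  obtain ⟨χ, G', hG'hom, hG'stab, hG'hw, p', hp', hG'p'⟩ :=
    stub_hwExtraction m (m * 2) _ (skewU m) G hGhom hGstab ⟨p, hp, hGp⟩
  have hG'0 : G' ≠ 0 := fun h => hG'p' (by rw [h, map_zero])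
  obtain ⟨lam, hcard, hχ⟩ := stub_weightOfPartition m (m * 2) χ G' hG'0 hG'hom hG'hw
  subst hχ
  -- `G' ∈ T(0)` at `(m, δ = 2, λ)` and the cut criterion
  have hmem : G' ∈ trunc m 2 lam 0 := by
    rw [trunc, truncU_zero]
    refine Submodule.mem_inf.mpr ⟨Submodule.mem_inf.mpr ⟨?_, ?_⟩, ?_⟩
    · exact (mem_homogeneousSubmodule _ _).mpr hG'hom
    · exact mem_stabInv_iff.mpr fun M hM => hG'stab M hM
    · exact mem_hwSp_iff.mpr hG'hw
  exact ⟨2, lam, hcard, finrank_lt_of_eval_ne_zero two_pos hmem hp' hG'p'⟩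

end

end Summit.ValiantsHypothesis.ValiantsHypothesis.Cruxes.CutBites.PencilDegreeFrobenius
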